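import Summits.NavierStokesRegularity.NavierStokesRegularity.Theorems.FilamentSkeletonRssNoExactProfileVorticityCaccioppoli

/-!
# Route `FilamentSkeletonRss` · negative item `NoExactProfileNearSymmetricPair` (stmt-NavierStokesRegularity-24091) — S_γ groundwork (B10):
# the VELOCITY CACCIOPPOLI IDENTITY for the rotating-Leray profile equation with C⁰ pressure (the L² input of the interior-regularity brick (M-a))

Helper file (theorems only), `--supports stmt-NavierStokesRegularity-24091 --as helper`; LEAD of 23611 / registrar of 23920, lane ns-filament-21221-p1 g15.

WHY.  Memo (A2)/(M-a): the window clause of 24091 controls `U` (and `|P| ≤ M`) only in C⁰.  Testing the profile equation `E_α(U) + ∇P = 0` against `η²U` (`η ∈ C²_c`) and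
removing every derivative by the whole-space divergence theorem (`div U = 0` makes the pressure term a C⁰ quantity) gives
  `∫ η²‖DU‖²_F = ¼∫ η²|U|² + ∫ |U|²·(½Δ(η²) + ηDη[v]) + 2∫ P·ηDη[U]`,  `v = U + ½y − αe₃×y`   (`velocity_caccioppoli_identity`):
the `L²` norm of `DU` (hence of `Ω = curl U`) under a cut-off is controlled by sup|U|, sup|P| and the cut-off geometry — the input of (B8) `vorticity_caccioppoli_*` and (B9)
`vorticity_component_sq_le`.  Compare the tree's `IsLerayProfile.integral_mul_frobeniusNormSq_eq` (rate 0, no rotation); here the Leray term contributes `+¼∫η²|U|²` and the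
rotation only enters through `v`.
HONEST FRAMING: groundwork on the NEGATIVE side of a HYPOTHETICAL filament-type rotating-self-similar blow-up route (MODEL rung); 24091/23611/23920 OPEN; nothing here bears on
Navier–Stokes regularity, which is NOT proved.
-/

set_option linter.dupNamespace false

noncomputable section

namespace Summit.NavierStokesRegularity.NavierStokesRegularity.Theorems.DefectColumnGate

open scoped BigOperators Topology InnerProductSpace Laplacian ContDiff
open Set Function MeasureTheory
open Literature.Analysis.FluidPDE
open Summit.NavierStokesRegularity.NavierStokesRegularity.Theorems.KelvinGate

/-- **Pointwise energy density of the profile equation.**  For `U ∈ C²`, `P` differentiable at `y`, `q = |U|²`, `v = U + ½y − αe₃×y`: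
`⟪E_α(U)(y) + ∇P(y), U(y)⟫ = ½Dq(y)[v(y)] + ½q(y) − (½Δq(y) − ‖DU(y)‖²_F) + DP(y)[U(y)]`. -/
theorem inner_lerayOp_add_gradient_self (α : ℝ) {U : EuclideanSpace ℝ (Fin 3) → EuclideanSpace ℝ (Fin 3)} {P : EuclideanSpace ℝ (Fin 3) → ℝ}
    (hU : ContDiff ℝ 2 U) (y : EuclideanSpace ℝ (Fin 3)) :
    ⟪lerayOp α U y + gradient P y, U y⟫_ℝ
      = (1/2:ℝ) * fderiv ℝ (fun z => ⟪U z, U z⟫_ℝ) y (U y + (1/2:ℝ) • y - α • cross (EuclideanSpace.single 2 1) y)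
        + (1/2:ℝ) * ⟪U y, U y⟫_ℝ - ((1/2:ℝ) * (Δ (fun z => ⟪U z, U z⟫_ℝ)) y - frobeniusNormSq (fderiv ℝ U y)) + fderiv ℝ P y (U y) := by
  have hU1 : Differentiable ℝ U := hU.differentiable (by norm_num)
  have hL : (Δ (fun z => ⟪U z, U z⟫_ℝ)) y = 2 * ⟪(Δ U) y, U y⟫_ℝ + 2 * frobeniusNormSq (fderiv ℝ U y) := laplacian_inner_self_eq hU y
  have hD : ∀ h, fderiv ℝ (fun z => ⟪U z, U z⟫_ℝ) y h = 2 * ⟪fderiv ℝ U y h, U y⟫_ℝ := fun h => by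
    rw [fderiv_inner_apply ℝ (hU1 y) (hU1 y) h, real_inner_comm (U y)]; ring
  have hskew : ⟪cross (EuclideanSpace.single 2 1) (U y), U y⟫_ℝ = 0 := by
    rw [cross_single_two_eq_rotGenL, rotGenL_apply, inner_rotGen_self]
  have hP : ⟪gradient P y, U y⟫_ℝ = fderiv ℝ P y (U y) := by rw [gradient, InnerProductSpace.toDual_symm_apply]
  simp only [lerayOp, inner_add_left, inner_sub_left, inner_smul_left, map_add, map_sub, map_smul, hskew, hP, RCLike.conj_to_real, hD]
  linarith

/-- **VELOCITY CACCIOPPOLI IDENTITY for the rotating-Leray profile equation.**  Let `U ∈ C²` be solenoidal and `P ∈ C¹` with `E_α(U) + ∇P = 0` pointwise, and `η ∈ C²`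
compactly supported.  Then, with `v = U + ½y − αe₃×y`,
`∫ η²‖DU‖²_F = ¼∫ η²|U|² + ∫ |U|²·(½Δ(η²) + ηDη[v]) + 2∫ P·ηDη[U]`. -/
theorem velocity_caccioppoli_identity (α : ℝ) {U : EuclideanSpace ℝ (Fin 3) → EuclideanSpace ℝ (Fin 3)} {P : EuclideanSpace ℝ (Fin 3) → ℝ}
    (hU : ContDiff ℝ 2 U) (hdiv : VectorCalculus.IsDivFree U) (hP : ContDiff ℝ 1 P) (hprof : ∀ y, lerayOp α U y + gradient P y = 0)
    {η : EuclideanSpace ℝ (Fin 3) → ℝ} (hη : ContDiff ℝ 2 η) (hηc : HasCompactSupport η) :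
    (∫ y, η y ^ 2 * frobeniusNormSq (fderiv ℝ U y))
      = (1/4:ℝ) * (∫ y, η y ^ 2 * ⟪U y, U y⟫_ℝ)
        + (∫ y, ⟪U y, U y⟫_ℝ * ((1/2:ℝ) * (Δ (fun z => η z ^ 2)) y + η y * fderiv ℝ η y (U y + (1/2:ℝ) • y - α • cross (EuclideanSpace.single 2 1) y)))
        + 2 * ∫ y, P y * (η y * fderiv ℝ η y (U y)) := by
  -- regularity
  have hU1 : ContDiff ℝ 1 U := hU.of_le (by norm_num)
  have hq : ContDiff ℝ 2 (fun z : EuclideanSpace ℝ (Fin 3) => ⟪U z, U z⟫_ℝ) := hU.inner ℝ hU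
  have hq1 : ContDiff ℝ 1 (fun z : EuclideanSpace ℝ (Fin 3) => ⟪U z, U z⟫_ℝ) := hq.of_le (by norm_num)
  have hθ : ContDiff ℝ 2 (fun z : EuclideanSpace ℝ (Fin 3) => η z ^ 2) := hη.pow 2
  have hθ1 : ContDiff ℝ 1 (fun z : EuclideanSpace ℝ (Fin 3) => η z ^ 2) := hθ.of_le (by norm_num)
  have hv : ContDiff ℝ 1 (fun z : EuclideanSpace ℝ (Fin 3) => U z + (1/2:ℝ) • z - α • cross (EuclideanSpace.single 2 1) z) := by
    simp only [cross_single_two_eq_rotGenL]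
    exact (hU1.add (contDiff_id.const_smul _)).sub (rotGenL.contDiff.const_smul _)
  have hgq : ContDiff ℝ 1 (gradient (fun z : EuclideanSpace ℝ (Fin 3) => ⟪U z, U z⟫_ℝ)) := contDiff_gradient_of_contDiff_succ (n := 1) hq
  have hgθ : ContDiff ℝ 1 (gradient (fun z : EuclideanSpace ℝ (Fin 3) => η z ^ 2)) := contDiff_gradient_of_contDiff_succ (n := 1) hθ
  have hθsub : tsupport (fun z : EuclideanSpace ℝ (Fin 3) => η z ^ 2) ⊆ tsupport η := closure_mono fun z hz => by
    simp only [mem_support] at hz ⊢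
    exact fun h0 => hz (by simp [h0])
  have hgθ0 : ∀ y ∉ tsupport η, gradient (fun z : EuclideanSpace ℝ (Fin 3) => η z ^ 2) y = 0 := fun y hy =>
    gradient_eq_zero_of_notMem_tsupport (fun h => hy (hθsub h))
  have hθ0 : ∀ y ∉ tsupport η, η y ^ 2 = 0 := fun y hy => by simp [image_eq_zero_of_notMem_tsupport hy]
  have hΔθ0 : ∀ y ∉ tsupport η, (Δ (fun z : EuclideanSpace ℝ (Fin 3) => η z ^ 2)) y = 0 := fun y hy =>
    laplacian_eq_zero_of_notMem_tsupport (fun h => hy (hθsub h))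
  have hDθ : ∀ y w, fderiv ℝ (fun z : EuclideanSpace ℝ (Fin 3) => η z ^ 2) y w = 2 * η y * fderiv ℝ η y w := fun y w => by
    have hd : DifferentiableAt ℝ η y := hη.differentiable (by norm_num) y
    rw [show (fun z : EuclideanSpace ℝ (Fin 3) => η z ^ 2) = fun z => η z * η z from funext fun z => sq (η z), fderiv_fun_mul hd hd]
    simp only [FunLike.coe_add, Pi.add_apply, FunLike.coe_smul, Pi.smul_apply, smul_eq_mul]; ring
  have hig : ∀ (g : EuclideanSpace ℝ (Fin 3) → ℝ) (y w : EuclideanSpace ℝ (Fin 3)), ⟪w, gradient g y⟫_ℝ = fderiv ℝ g y w := fun g y w => by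
    rw [real_inner_comm, gradient, InnerProductSpace.toDual_symm_apply]
  -- four compactly supported `C¹` fields
  set A : EuclideanSpace ℝ (Fin 3) → EuclideanSpace ℝ (Fin 3) := fun z => (η z ^ 2) • gradient (fun z : EuclideanSpace ℝ (Fin 3) => ⟪U z, U z⟫_ℝ) z with hA
  set C : EuclideanSpace ℝ (Fin 3) → EuclideanSpace ℝ (Fin 3) := fun z => ⟪U z, U z⟫_ℝ • gradient (fun z : EuclideanSpace ℝ (Fin 3) => η z ^ 2) z with hC
  set F₁ : EuclideanSpace ℝ (Fin 3) → EuclideanSpace ℝ (Fin 3) :=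
    fun z => (η z ^ 2 * ⟪U z, U z⟫_ℝ) • (U z + (1/2:ℝ) • z - α • cross (EuclideanSpace.single 2 1) z) with hF₁
  set F₂ : EuclideanSpace ℝ (Fin 3) → EuclideanSpace ℝ (Fin 3) := fun z => (η z ^ 2 * P z) • U z with hF₂
  have hA1 : ContDiff ℝ 1 A := hθ1.smul hgq
  have hC1 : ContDiff ℝ 1 C := hq1.smul hgθ
  have hF₁1 : ContDiff ℝ 1 F₁ := (hθ1.mul hq1).smul hv
  have hF₂1 : ContDiff ℝ 1 F₂ := (hθ1.mul hP).smul hU1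
  have hAc : HasCompactSupport A := HasCompactSupport.intro' hηc (isClosed_tsupport η) fun y hy => by simp only [hA, hθ0 y hy, zero_smul]
  have hCc : HasCompactSupport C := HasCompactSupport.intro' hηc (isClosed_tsupport η) fun y hy => by simp only [hC, hgθ0 y hy, smul_zero]
  have hF₁c : HasCompactSupport F₁ := HasCompactSupport.intro' hηc (isClosed_tsupport η) fun y hy => by simp only [hF₁, hθ0 y hy, zero_mul, zero_smul]
  have hF₂c : HasCompactSupport F₂ := HasCompactSupport.intro' hηc (isClosed_tsupport η) fun y hy => by simp only [hF₂, hθ0 y hy, zero_mul, zero_smul]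
  -- divergences
  have hdivA : ∀ y, VectorCalculus.divergence A y = η y ^ 2 * (Δ (fun z : EuclideanSpace ℝ (Fin 3) => ⟪U z, U z⟫_ℝ)) y
      + ⟪gradient (fun z : EuclideanSpace ℝ (Fin 3) => ⟪U z, U z⟫_ℝ) y, gradient (fun z : EuclideanSpace ℝ (Fin 3) => η z ^ 2) y⟫_ℝ := fun y => by
    rw [hA, divergence_smul_apply (hθ1.differentiable (by norm_num) y) (hgq.differentiable (by norm_num) y), divergence_gradient_eq_laplacian hq]
  have hdivC : ∀ y, VectorCalculus.divergence C y = ⟪U y, U y⟫_ℝ * (Δ (fun z : EuclideanSpace ℝ (Fin 3) => η z ^ 2)) y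
      + ⟪gradient (fun z : EuclideanSpace ℝ (Fin 3) => η z ^ 2) y, gradient (fun z : EuclideanSpace ℝ (Fin 3) => ⟪U z, U z⟫_ℝ) y⟫_ℝ := fun y => by
    rw [hC, divergence_smul_apply (hq1.differentiable (by norm_num) y) (hgθ.differentiable (by norm_num) y), divergence_gradient_eq_laplacian hθ]
  have hdivF₁ : ∀ y, VectorCalculus.divergence F₁ y = (η y ^ 2 * ⟪U y, U y⟫_ℝ) * (3/2)
      + (η y ^ 2 * fderiv ℝ (fun z : EuclideanSpace ℝ (Fin 3) => ⟪U z, U z⟫_ℝ) y (U y + (1/2:ℝ) • y - α • cross (EuclideanSpace.single 2 1) y)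
        + ⟪U y, U y⟫_ℝ * (2 * η y * fderiv ℝ η y (U y + (1/2:ℝ) • y - α • cross (EuclideanSpace.single 2 1) y))) := fun y => by
    have hd1 : DifferentiableAt ℝ (fun z : EuclideanSpace ℝ (Fin 3) => η z ^ 2 * ⟪U z, U z⟫_ℝ) y :=
      (hθ1.differentiable (by norm_num) y).mul (hq1.differentiable (by norm_num) y)
    rw [hF₁, divergence_smul_apply hd1 (hv.differentiable (by norm_num) y), divergence_frameField hU1 hdiv α y, hig,
      fderiv_fun_mul (hθ1.differentiable (by norm_num) y) (hq1.differentiable (by norm_num) y)]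
    simp only [FunLike.coe_add, Pi.add_apply, FunLike.coe_smul, Pi.smul_apply, smul_eq_mul, hDθ]
  have hdivF₂ : ∀ y, VectorCalculus.divergence F₂ y = η y ^ 2 * fderiv ℝ P y (U y) + P y * (2 * η y * fderiv ℝ η y (U y)) := fun y => by
    have hd1 : DifferentiableAt ℝ (fun z : EuclideanSpace ℝ (Fin 3) => η z ^ 2 * P z) y :=
      (hθ1.differentiable (by norm_num) y).mul (hP.differentiable (by norm_num) y)
    rw [hF₂, divergence_smul_apply hd1 (hU1.differentiable (by norm_num) y), hdiv y, mul_zero, zero_add, hig,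
      fderiv_fun_mul (hθ1.differentiable (by norm_num) y) (hP.differentiable (by norm_num) y)]
    simp only [FunLike.coe_add, Pi.add_apply, FunLike.coe_smul, Pi.smul_apply, smul_eq_mul, hDθ]
  -- pointwise: `η²‖DU‖²_F − [claimed density] = ½div A − ½div C − ½div F₁ − div F₂`
  have hpt : ∀ y, η y ^ 2 * frobeniusNormSq (fderiv ℝ U y) - (1/4:ℝ) * (η y ^ 2 * ⟪U y, U y⟫_ℝ)
      - ⟪U y, U y⟫_ℝ * ((1/2:ℝ) * (Δ (fun z : EuclideanSpace ℝ (Fin 3) => η z ^ 2)) y + η y * fderiv ℝ η y (U y + (1/2:ℝ) • y - α • cross (EuclideanSpace.single 2 1) y))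
      - 2 * (P y * (η y * fderiv ℝ η y (U y)))
      = (1/2:ℝ) * VectorCalculus.divergence A y - (1/2:ℝ) * VectorCalculus.divergence C y - (1/2:ℝ) * VectorCalculus.divergence F₁ y
        - VectorCalculus.divergence F₂ y := by
    intro y
    have hE := inner_lerayOp_add_gradient_self α (P := P) hU y
    rw [hprof y, inner_zero_left] at hE
    rw [hdivA, hdivC, hdivF₁, hdivF₂]
    have hcomm : ⟪gradient (fun z : EuclideanSpace ℝ (Fin 3) => η z ^ 2) y, gradient (fun z : EuclideanSpace ℝ (Fin 3) => ⟪U z, U z⟫_ℝ) y⟫_ℝ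
        = ⟪gradient (fun z : EuclideanSpace ℝ (Fin 3) => ⟪U z, U z⟫_ℝ) y, gradient (fun z : EuclideanSpace ℝ (Fin 3) => η z ^ 2) y⟫_ℝ := real_inner_comm _ _
    have h3 : η y ^ 2 * ((1/2:ℝ) * fderiv ℝ (fun z => ⟪U z, U z⟫_ℝ) y (U y + (1/2:ℝ) • y - α • cross (EuclideanSpace.single 2 1) y)
        + (1/2:ℝ) * ⟪U y, U y⟫_ℝ - ((1/2:ℝ) * (Δ (fun z => ⟪U z, U z⟫_ℝ)) y - frobeniusNormSq (fderiv ℝ U y)) + fderiv ℝ P y (U y)) = 0 := by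
      rw [← hE, mul_zero]
    linarith [hcomm]
  -- integrate
  have hIA := integral_divergence_eq_zero hA1 hAc
  have hIC := integral_divergence_eq_zero hC1 hCc
  have hIF₁ := integral_divergence_eq_zero hF₁1 hF₁c
  have hIF₂ := integral_divergence_eq_zero hF₂1 hF₂c
  have idiv : ∀ {F : EuclideanSpace ℝ (Fin 3) → EuclideanSpace ℝ (Fin 3)}, ContDiff ℝ 1 F → HasCompactSupport F →
      Integrable (fun y => VectorCalculus.divergence F y) := fun hF1 hFc =>
    (continuous_divergence (hF1.continuous_fderiv (by norm_num))).integrable_of_hasCompactSupport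
      (hFc.mono' fun y hy => by contrapose! hy; simp [divergence_eq_zero_of_notMem_tsupport hy])
  have idA := idiv hA1 hAc
  have idC := idiv hC1 hCc
  have idF₁ := idiv hF₁1 hF₁c
  have idF₂ := idiv hF₂1 hF₂c
  have j1 : Integrable (fun y => (1/2:ℝ) * VectorCalculus.divergence A y - (1/2:ℝ) * VectorCalculus.divergence C y) := (idA.const_mul _).sub (idC.const_mul _)
  have j2 : Integrable (fun y => (1/2:ℝ) * VectorCalculus.divergence A y - (1/2:ℝ) * VectorCalculus.divergence C y - (1/2:ℝ) * VectorCalculus.divergence F₁ y) :=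
    j1.sub (idF₁.const_mul _)
  have hint0 := integral_congr_ae (μ := (volume : Measure (EuclideanSpace ℝ (Fin 3)))) (Filter.Eventually.of_forall hpt)
  rw [integral_sub j2 idF₂, integral_sub j1 (idF₁.const_mul _), integral_sub (idA.const_mul _) (idC.const_mul _),
    integral_const_mul, integral_const_mul, integral_const_mul, hIA, hIC, hIF₁, hIF₂] at hint0
  -- integrability of the four densities
  have hF : Continuous fun y => frobeniusNormSq (fderiv ℝ U y) := by
    have hDU : Continuous (fderiv ℝ U) := hU.continuous_fderiv (by norm_num)
    simp only [frobeniusNormSq_eq_sum (EuclideanSpace.basisFun (Fin 3) ℝ)]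
    fun_prop
  have hUc : Continuous U := hU.continuous
  have hPc : Continuous P := hP.continuous
  have hηc' : Continuous η := hη.continuous
  have hDη : Continuous (fderiv ℝ η) := hη.continuous_fderiv (by norm_num)
  have hΔθ : Continuous (Δ (fun z : EuclideanSpace ℝ (Fin 3) => η z ^ 2)) := continuous_laplacian hθ
  have hsupp : ∀ {g : EuclideanSpace ℝ (Fin 3) → ℝ}, (∀ y ∉ tsupport η, g y = 0) → HasCompactSupport g := fun hg =>
    HasCompactSupport.intro' hηc (isClosed_tsupport η) hg
  have i1 : Integrable (fun y => η y ^ 2 * frobeniusNormSq (fderiv ℝ U y)) :=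
    Continuous.integrable_of_hasCompactSupport (by fun_prop) (hsupp fun y hy => by rw [hθ0 y hy, zero_mul])
  have i2 : Integrable (fun y => η y ^ 2 * ⟪U y, U y⟫_ℝ) :=
    Continuous.integrable_of_hasCompactSupport (by fun_prop) (hsupp fun y hy => by rw [hθ0 y hy, zero_mul])
  have i3 : Integrable (fun y => ⟪U y, U y⟫_ℝ * ((1/2:ℝ) * (Δ (fun z : EuclideanSpace ℝ (Fin 3) => η z ^ 2)) y
      + η y * fderiv ℝ η y (U y + (1/2:ℝ) • y - α • cross (EuclideanSpace.single 2 1) y))) := by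
    refine Continuous.integrable_of_hasCompactSupport ?_ (hsupp fun y hy => ?_)
    · simp only [cross_single_two_eq_rotGenL]; fun_prop
    · rw [hΔθ0 y hy, image_eq_zero_of_notMem_tsupport hy]; ring
  have i4 : Integrable (fun y => P y * (η y * fderiv ℝ η y (U y))) :=
    Continuous.integrable_of_hasCompactSupport (by fun_prop) (hsupp fun y hy => by rw [image_eq_zero_of_notMem_tsupport hy]; ring)
  have k1 : Integrable (fun y => η y ^ 2 * frobeniusNormSq (fderiv ℝ U y) - (1/4:ℝ) * (η y ^ 2 * ⟪U y, U y⟫_ℝ)) := i1.sub (i2.const_mul _)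
  have k2 : Integrable (fun y => η y ^ 2 * frobeniusNormSq (fderiv ℝ U y) - (1/4:ℝ) * (η y ^ 2 * ⟪U y, U y⟫_ℝ)
      - ⟪U y, U y⟫_ℝ * ((1/2:ℝ) * (Δ (fun z : EuclideanSpace ℝ (Fin 3) => η z ^ 2)) y
        + η y * fderiv ℝ η y (U y + (1/2:ℝ) • y - α • cross (EuclideanSpace.single 2 1) y))) := k1.sub i3
  rw [integral_sub k2 (i4.const_mul 2), integral_sub k1 i3, integral_sub i1 (i2.const_mul _), integral_const_mul, integral_const_mul] at hint0
  linarith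

end Summit.NavierStokesRegularity.NavierStokesRegularity.Theorems.DefectColumnGate

end
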